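import Literature.Computability.AlgebraicComplexity.IsotypicOccurrenceSemigroup
import HarnessLib

/-!
# Occurring triples transform under permutations of the tensor factors; `S(⟨r⟩)` is `S₃`-symmetric

Topic `Computability/AlgebraicComplexity`; proofs file (theorems only, no definitions, no named
facts) of the named fact `vandenBergEtAl2025_unitTensor_four_polytope_maximal`
(`UnitTensorMomentPolytope.lean`: "`Δ(⟨4⟩) = Kron(4,4,4)`" in semigroup form). The printed argument
for that fact checks the vertices of `Kron(4,4,4)` "(up to permutations of the factors)" — the
authors' vertex list (arXiv:2510.08336, Table 8 and the data repository, `kronecker_4x4x4`: 328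
vertices) is given modulo the action of `S₃` permuting the three tensor factors, which is legitimate
because "The unit tensor `⟨r⟩` is `S₃`-invariant. […] As a result, the moment polytopes `Δ(⟨r⟩)` and
`Δ(M_n)` are `S₃`-invariant" [vandenBergChristandlLysikovNieuwboerWalterZuiddam2025, §1, after
Thm. 1.4: "The symmetric group `S₃` acts on any tensor space `ℂᵃ ⊗ ℂᵇ ⊗ ℂᶜ` by permuting the factors,
and similarly acts on any moment polytope by permuting the three components"]. This file PROVES that
symmetry at the level of OCCURRING TRIPLES (the tree's coordinates for `S(t)` / `Δ(t)`: non-vanishing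
of `isotypicSum₁ λ⁰ ∘ isotypicSum₂ λ¹ ∘ isotypicSum₃ λ²` on `kroneckerPow t n`):

* `isotypicSum₁₂₃_kroneckerPow_swap₁₂`, `…_swap₂₃` — swapping two factors of `t` swaps the
  corresponding isotypic sums: `P_{(μ,λ,ν)} (t^{σ})^{⊗n} = (P_{(λ,μ,ν)} t^{⊗n})^{σ}` for the
  transpositions `σ = (12), (23)` (which generate `S₃`); hence the `≠ 0` equivalences
  `isotypicSum₁₂₃_kroneckerPow_ne_zero_swap₁₂_iff`, `…_swap₂₃_iff`:
  `(λ⁰,λ¹,λ²)` occurs in `(t^{(12)})^{⊗n}` iff `(λ¹,λ⁰,λ²)` occurs in `t^{⊗n}`, etc.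
* `unitTensor_swap₁₂`, `unitTensor_swap₂₃` — `⟨r⟩` is `S₃`-invariant; so
  `isotypicSum₁₂₃_kroneckerPow_unitTensor_ne_zero_swap₁₂_iff`, `…_swap₂₃_iff`: the set of triples
  occurring in powers of `⟨r⟩` is invariant under permuting the three partitions, and so is the set of
  triples "a multiple of which occurs in a power of `⟨4⟩`" — the conclusion of the named fact —
  (`exists_mul_occurs_unitTensor_swap₁₂`, `…_swap₂₃`). Consequently, in any "check the generators"
  proof of the named fact (`UnitTensorMomentPolytopeReduction.lean`) one representative per
  `S₃`-orbit of generators suffices.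

## References

* [vandenBergChristandlLysikovNieuwboerWalterZuiddam2025] M. van den Berg, M. Christandl, V. Lysikov,
  H. Nieuwboer, M. Walter, J. Zuiddam, *The moment polytope of matrix multiplication is not maximal*,
  arXiv:2503.22633, §1 (the `S₃`-symmetry paragraph after Thm. 1.4; "Moreover, `Δ(⟨4⟩)` equals
  `Kron₄₄₄` …" after Cor. 1.5).
* [vandenBergEtAl2025ComputingMomentPolytopes] same authors, arXiv:2510.08336, §6.5, Table 8
  ("up to permutations of the factors").
* [ChristandlVranaZuiddam2023] M. Christandl, P. Vrana, J. Zuiddam, J. Amer. Math. Soc. 36 (2023),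
  §3.1 (the projectors `P_λ^{V_j}`), Lemma 3.2 (they commute).
-/

noncomputable section

open scoped BigOperators

namespace Literature.Computability.AlgebraicComplexity

universe u

/-! ## Swapping factors commutes with powers and transforms the isotypic sums -/

section Swap

variable {K : Type*} [CommSemiring K] {ι κ μ : Type*} {n : ℕ}

/-- `(t^{(12)})^{⊗n} = (t^{⊗n})^{(12)}`: the power of the factor-swapped tensor is the factor-swapped
power. [folklore] -/
theorem kroneckerPow_swap₁₂ (t : ι → κ → μ → K) (n : ℕ) :
    kroneckerPow (fun b a c => t a b c) n = fun B A C => kroneckerPow t n A B C := by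
  funext B A C
  simp only [kroneckerPow_apply]

/-- `(t^{(23)})^{⊗n} = (t^{⊗n})^{(23)}`. [folklore] -/
theorem kroneckerPow_swap₂₃ (t : ι → κ → μ → K) (n : ℕ) :
    kroneckerPow (fun a c b => t a b c) n = fun A C B => kroneckerPow t n A B C := by
  funext A C B
  simp only [kroneckerPow_apply]

end Swap

section SwapIsotypic

variable {ι κ μ : Type*} {n : ℕ}

/-- The isotypic sum on the first factor of a `(12)`-swapped tensor is the isotypic sum on the second
factor, swapped. [cite: ChristandlVranaZuiddam2023, §3.1] -/
theorem isotypicSum₁_swap₁₂ (lam : Nat.Partition n) (u : (Fin n → ι) → (Fin n → κ) → (Fin n → μ) → ℂ) :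
    isotypicSum₁ lam (fun B A C => u A B C) = fun B A C => isotypicSum₂ lam u A B C := by
  funext B A C
  simp only [isotypicSum₁_apply, isotypicSum₂_apply]

/-- The isotypic sum on the second factor of a `(12)`-swapped tensor is the isotypic sum on the first
factor, swapped. [cite: ChristandlVranaZuiddam2023, §3.1] -/
theorem isotypicSum₂_swap₁₂ (lam : Nat.Partition n) (u : (Fin n → ι) → (Fin n → κ) → (Fin n → μ) → ℂ) :
    isotypicSum₂ lam (fun B A C => u A B C) = fun B A C => isotypicSum₁ lam u A B C := by
  funext B A C
  simp only [isotypicSum₁_apply, isotypicSum₂_apply]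

/-- The isotypic sum on the third factor commutes with the `(12)`-swap. [cite: ChristandlVranaZuiddam2023, §3.1] -/
theorem isotypicSum₃_swap₁₂ (lam : Nat.Partition n) (u : (Fin n → ι) → (Fin n → κ) → (Fin n → μ) → ℂ) :
    isotypicSum₃ lam (fun B A C => u A B C) = fun B A C => isotypicSum₃ lam u A B C := by
  funext B A C
  simp only [isotypicSum₃_apply]

/-- The isotypic sum on the first factor commutes with the `(23)`-swap. [cite: ChristandlVranaZuiddam2023, §3.1] -/
theorem isotypicSum₁_swap₂₃ (lam : Nat.Partition n) (u : (Fin n → ι) → (Fin n → κ) → (Fin n → μ) → ℂ) :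
    isotypicSum₁ lam (fun A C B => u A B C) = fun A C B => isotypicSum₁ lam u A B C := by
  funext A C B
  simp only [isotypicSum₁_apply]

/-- The isotypic sum on the second factor of a `(23)`-swapped tensor is the isotypic sum on the third
factor, swapped. [cite: ChristandlVranaZuiddam2023, §3.1] -/
theorem isotypicSum₂_swap₂₃ (lam : Nat.Partition n) (u : (Fin n → ι) → (Fin n → κ) → (Fin n → μ) → ℂ) :
    isotypicSum₂ lam (fun A C B => u A B C) = fun A C B => isotypicSum₃ lam u A B C := by
  funext A C B
  simp only [isotypicSum₂_apply, isotypicSum₃_apply]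

/-- The isotypic sum on the third factor of a `(23)`-swapped tensor is the isotypic sum on the second
factor, swapped. [cite: ChristandlVranaZuiddam2023, §3.1] -/
theorem isotypicSum₃_swap₂₃ (lam : Nat.Partition n) (u : (Fin n → ι) → (Fin n → κ) → (Fin n → μ) → ℂ) :
    isotypicSum₃ lam (fun A C B => u A B C) = fun A C B => isotypicSum₂ lam u A B C := by
  funext A C B
  simp only [isotypicSum₂_apply, isotypicSum₃_apply]

/-- **The triple isotypic sum of a factor-swapped power, `σ = (12)`**:
`P_{(μ,λ,ν)} ((t^{(12)})^{⊗n}) = (P_{(λ,μ,ν)} t^{⊗n})^{(12)}` (the projectors on different factors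
commute, CVZ Lemma 3.2). [cite: ChristandlVranaZuiddam2023, Lemma 3.2] -/
theorem isotypicSum₁₂₃_kroneckerPow_swap₁₂ (t : ι → κ → μ → ℂ) (lam0 lam1 lam2 : Nat.Partition n) :
    isotypicSum₁ lam1 (isotypicSum₂ lam0 (isotypicSum₃ lam2 (kroneckerPow (fun b a c => t a b c) n))) =
      fun B A C => isotypicSum₁ lam0 (isotypicSum₂ lam1 (isotypicSum₃ lam2 (kroneckerPow t n))) A B C := by
  rw [kroneckerPow_swap₁₂, isotypicSum₃_swap₁₂, isotypicSum₂_swap₁₂, isotypicSum₁_swap₁₂,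
    isotypicSum₁_isotypicSum₂]

/-- **The triple isotypic sum of a factor-swapped power, `σ = (23)`**:
`P_{(λ,ν,μ)} ((t^{(23)})^{⊗n}) = (P_{(λ,μ,ν)} t^{⊗n})^{(23)}`. [cite: ChristandlVranaZuiddam2023, Lemma 3.2] -/
theorem isotypicSum₁₂₃_kroneckerPow_swap₂₃ (t : ι → κ → μ → ℂ) (lam0 lam1 lam2 : Nat.Partition n) :
    isotypicSum₁ lam0 (isotypicSum₂ lam2 (isotypicSum₃ lam1 (kroneckerPow (fun a c b => t a b c) n))) =
      fun A C B => isotypicSum₁ lam0 (isotypicSum₂ lam1 (isotypicSum₃ lam2 (kroneckerPow t n))) A B C := by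
  rw [kroneckerPow_swap₂₃, isotypicSum₃_swap₂₃, isotypicSum₂_swap₂₃, isotypicSum₁_swap₂₃,
    isotypicSum₂_isotypicSum₃]

/-- A `(12)`-swapped 3-tensor vanishes iff the tensor does. [folklore] -/
theorem swap₁₂_ne_zero_iff {α β γ : Type*} (v : α → β → γ → ℂ) :
    (fun B A C => v A B C) ≠ 0 ↔ v ≠ 0 := by
  refine not_congr ⟨fun h => ?_, fun h => ?_⟩
  · funext A B C
    exact congrFun (congrFun (congrFun h B) A) C
  · subst h
    rfl

/-- A `(23)`-swapped 3-tensor vanishes iff the tensor does. [folklore] -/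
theorem swap₂₃_ne_zero_iff {α β γ : Type*} (v : α → β → γ → ℂ) :
    (fun A C B => v A B C) ≠ 0 ↔ v ≠ 0 := by
  refine not_congr ⟨fun h => ?_, fun h => ?_⟩
  · funext A B C
    exact congrFun (congrFun (congrFun h A) C) B
  · subst h
    rfl

/-- **Occurrence under the factor swap `(12)`**: `(λ¹, λ⁰, λ²)` occurs in `(t^{(12)})^{⊗n}` iff
`(λ⁰, λ¹, λ²)` occurs in `t^{⊗n}` — "`S₃` acts on any moment polytope by permuting the three
components". [cite: vandenBergChristandlLysikovNieuwboerWalterZuiddam2025, §1 (after Thm. 1.4)] -/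
theorem isotypicSum₁₂₃_kroneckerPow_ne_zero_swap₁₂_iff (t : ι → κ → μ → ℂ)
    (lam0 lam1 lam2 : Nat.Partition n) :
    isotypicSum₁ lam1 (isotypicSum₂ lam0 (isotypicSum₃ lam2 (kroneckerPow (fun b a c => t a b c) n))) ≠ 0 ↔
      isotypicSum₁ lam0 (isotypicSum₂ lam1 (isotypicSum₃ lam2 (kroneckerPow t n))) ≠ 0 := by
  rw [isotypicSum₁₂₃_kroneckerPow_swap₁₂, swap₁₂_ne_zero_iff]

/-- **Occurrence under the factor swap `(23)`**: `(λ⁰, λ², λ¹)` occurs in `(t^{(23)})^{⊗n}` iff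
`(λ⁰, λ¹, λ²)` occurs in `t^{⊗n}`. [cite: vandenBergChristandlLysikovNieuwboerWalterZuiddam2025, §1 (after Thm. 1.4)] -/
theorem isotypicSum₁₂₃_kroneckerPow_ne_zero_swap₂₃_iff (t : ι → κ → μ → ℂ)
    (lam0 lam1 lam2 : Nat.Partition n) :
    isotypicSum₁ lam0 (isotypicSum₂ lam2 (isotypicSum₃ lam1 (kroneckerPow (fun a c b => t a b c) n))) ≠ 0 ↔
      isotypicSum₁ lam0 (isotypicSum₂ lam1 (isotypicSum₃ lam2 (kroneckerPow t n))) ≠ 0 := by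
  rw [isotypicSum₁₂₃_kroneckerPow_swap₂₃, swap₂₃_ne_zero_iff]

end SwapIsotypic

/-! ## The unit tensor is `S₃`-invariant; its occurring triples are closed under permutation -/

section UnitTensor

variable {K : Type*} [CommSemiring K]

variable (K) in
/-- `⟨r⟩` is invariant under swapping the first two factors ("The unit tensor `⟨r⟩` is `S₃`-invariant").
[cite: vandenBergChristandlLysikovNieuwboerWalterZuiddam2025, §1 (after Thm. 1.4)] -/
theorem unitTensor_swap₁₂ (r : ℕ) : (fun b a c => unitTensor K r a b c) = unitTensor K r := by
  funext x y z
  simp only [unitTensor_apply]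
  by_cases h : x = y ∧ y = z
  · rw [if_pos ⟨h.1.symm, h.1.trans h.2⟩, if_pos h]
  · rw [if_neg (fun h' => h ⟨h'.1.symm, h'.1.trans h'.2⟩), if_neg h]

variable (K) in
/-- `⟨r⟩` is invariant under swapping the last two factors.
[cite: vandenBergChristandlLysikovNieuwboerWalterZuiddam2025, §1 (after Thm. 1.4)] -/
theorem unitTensor_swap₂₃ (r : ℕ) : (fun a c b => unitTensor K r a b c) = unitTensor K r := by
  funext a c b
  simp only [unitTensor_apply]
  by_cases h : a = c ∧ c = b
  · rw [if_pos ⟨h.1.trans h.2, h.2.symm⟩, if_pos h]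
  · rw [if_neg (fun h' => h ⟨h'.1.trans h'.2, h'.2.symm⟩), if_neg h]

variable {n : ℕ}

/-- **`S(⟨r⟩)` is invariant under `(12)`**: `(λ¹, λ⁰, λ²)` occurs in `⟨r⟩^{⊗n}` iff `(λ⁰, λ¹, λ²)`
does ("the moment polytope `Δ(⟨r⟩)` is `S₃`-invariant").
[cite: vandenBergChristandlLysikovNieuwboerWalterZuiddam2025, §1 (after Thm. 1.4)] -/
theorem isotypicSum₁₂₃_kroneckerPow_unitTensor_ne_zero_swap₁₂_iff (r : ℕ)
    (lam0 lam1 lam2 : Nat.Partition n) :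
    isotypicSum₁ lam1 (isotypicSum₂ lam0 (isotypicSum₃ lam2 (kroneckerPow (unitTensor ℂ r) n))) ≠ 0 ↔
      isotypicSum₁ lam0 (isotypicSum₂ lam1 (isotypicSum₃ lam2 (kroneckerPow (unitTensor ℂ r) n))) ≠ 0 := by
  conv_lhs => rw [← unitTensor_swap₁₂ ℂ r]
  exact isotypicSum₁₂₃_kroneckerPow_ne_zero_swap₁₂_iff _ _ _ _

/-- **`S(⟨r⟩)` is invariant under `(23)`**: `(λ⁰, λ², λ¹)` occurs in `⟨r⟩^{⊗n}` iff `(λ⁰, λ¹, λ²)`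
does. [cite: vandenBergChristandlLysikovNieuwboerWalterZuiddam2025, §1 (after Thm. 1.4)] -/
theorem isotypicSum₁₂₃_kroneckerPow_unitTensor_ne_zero_swap₂₃_iff (r : ℕ)
    (lam0 lam1 lam2 : Nat.Partition n) :
    isotypicSum₁ lam0 (isotypicSum₂ lam2 (isotypicSum₃ lam1 (kroneckerPow (unitTensor ℂ r) n))) ≠ 0 ↔
      isotypicSum₁ lam0 (isotypicSum₂ lam1 (isotypicSum₃ lam2 (kroneckerPow (unitTensor ℂ r) n))) ≠ 0 := by
  conv_lhs => rw [← unitTensor_swap₂₃ ℂ r]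
  exact isotypicSum₁₂₃_kroneckerPow_ne_zero_swap₂₃_iff _ _ _ _

/-- **The conclusion of `vandenBergEtAl2025_unitTensor_four_polytope_maximal` is `(12)`-symmetric**:
if a multiple of the triple `λ = (λ⁰, λ¹, λ²) ⊢ n` occurs in a power of `⟨r⟩`, then so does the same
multiple of `(λ¹, λ⁰, λ²)` — so generators of `Kron` need only be checked up to permutation of the
factors, as in the source's vertex list.
[cite: vandenBergChristandlLysikovNieuwboerWalterZuiddam2025, §1 (after Thm. 1.4 and after Cor. 1.5)] -/
theorem exists_mul_occurs_unitTensor_swap₁₂ (r : ℕ) {lam : Fin 3 → Nat.Partition n}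
    (h : ∃ (k : ℕ) (mu : Fin 3 → Nat.Partition (k * n)), 0 < k ∧
      (∀ j, (mu j).parts = (lam j).parts.map (fun p => k * p)) ∧
        isotypicSum₁ (mu 0) (isotypicSum₂ (mu 1) (isotypicSum₃ (mu 2)
          (kroneckerPow (unitTensor ℂ r) (k * n)))) ≠ 0) :
    ∃ (k : ℕ) (mu : Fin 3 → Nat.Partition (k * n)), 0 < k ∧
      (∀ j, (mu j).parts = ((lam ∘ Equiv.swap (0 : Fin 3) 1) j).parts.map (fun p => k * p)) ∧
        isotypicSum₁ (mu 0) (isotypicSum₂ (mu 1) (isotypicSum₃ (mu 2)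
          (kroneckerPow (unitTensor ℂ r) (k * n)))) ≠ 0 := by
  obtain ⟨k, mu, hk, hmu, hocc⟩ := h
  refine ⟨k, mu ∘ Equiv.swap (0 : Fin 3) 1, hk, fun j => hmu _, ?_⟩
  have e0 : (mu ∘ Equiv.swap (0 : Fin 3) 1) 0 = mu 1 := by simp
  have e1 : (mu ∘ Equiv.swap (0 : Fin 3) 1) 1 = mu 0 := by simp
  have e2 : (mu ∘ Equiv.swap (0 : Fin 3) 1) 2 = mu 2 := by
    simp [Equiv.swap_apply_of_ne_of_ne]
  rw [e0, e1, e2]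
  exact (isotypicSum₁₂₃_kroneckerPow_unitTensor_ne_zero_swap₁₂_iff r (mu 0) (mu 1) (mu 2)).2 hocc

/-- **The conclusion of `vandenBergEtAl2025_unitTensor_four_polytope_maximal` is `(23)`-symmetric**
(with `(12)` this generates the full `S₃`-symmetry).
[cite: vandenBergChristandlLysikovNieuwboerWalterZuiddam2025, §1 (after Thm. 1.4 and after Cor. 1.5)] -/
theorem exists_mul_occurs_unitTensor_swap₂₃ (r : ℕ) {lam : Fin 3 → Nat.Partition n}
    (h : ∃ (k : ℕ) (mu : Fin 3 → Nat.Partition (k * n)), 0 < k ∧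
      (∀ j, (mu j).parts = (lam j).parts.map (fun p => k * p)) ∧
        isotypicSum₁ (mu 0) (isotypicSum₂ (mu 1) (isotypicSum₃ (mu 2)
          (kroneckerPow (unitTensor ℂ r) (k * n)))) ≠ 0) :
    ∃ (k : ℕ) (mu : Fin 3 → Nat.Partition (k * n)), 0 < k ∧
      (∀ j, (mu j).parts = ((lam ∘ Equiv.swap (1 : Fin 3) 2) j).parts.map (fun p => k * p)) ∧
        isotypicSum₁ (mu 0) (isotypicSum₂ (mu 1) (isotypicSum₃ (mu 2)
          (kroneckerPow (unitTensor ℂ r) (k * n)))) ≠ 0 := by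
  obtain ⟨k, mu, hk, hmu, hocc⟩ := h
  refine ⟨k, mu ∘ Equiv.swap (1 : Fin 3) 2, hk, fun j => hmu _, ?_⟩
  have e0 : (mu ∘ Equiv.swap (1 : Fin 3) 2) 0 = mu 0 := by
    simp [Equiv.swap_apply_of_ne_of_ne]
  have e1 : (mu ∘ Equiv.swap (1 : Fin 3) 2) 1 = mu 2 := by simp
  have e2 : (mu ∘ Equiv.swap (1 : Fin 3) 2) 2 = mu 1 := by simp
  rw [e0, e1, e2]
  exact (isotypicSum₁₂₃_kroneckerPow_unitTensor_ne_zero_swap₂₃_iff r (mu 0) (mu 1) (mu 2)).2 hocc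

end UnitTensor

end Literature.Computability.AlgebraicComplexity
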